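import Summits.HodgeConjecture.HodgeConjecture.Theses.VHCAbelianSchemesRoad
import Summits.HodgeConjecture.HodgeConjecture.Theorems.VHCAbelianSchemesRoadLocallyServedAnchor
import Summits.HodgeConjecture.HodgeConjecture.Theorems.VHCAbelianSchemesRoadSecantQuotientAnchorPinnedDefs
import Summits.HodgeConjecture.HodgeConjecture.Theorems.VHCAbelianSchemesRoadTwistedDoorPrimeIsoRespects
import Summits.HodgeConjecture.HodgeConjecture.Theorems.VHCAbelianSchemesRoadLocallyServedAnchorCarriedPair
import Summits.HodgeConjecture.HodgeConjecture.Theorems.VHCAbelianSchemesRoadSecantQuotientOffHyperellipticOfPrintForall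
import Literature.AlgebraicGeometry.HodgeTheory.SecantQuotientJacobianTwistedCarrierForall
import Summits.HodgeConjecture.HodgeConjecture.Theorems.VHCAbelianSchemesRoadSecondCarriedHGoodTypingDefs
import Summits.HodgeConjecture.HodgeConjecture.Theorems.VHCAbelianSchemesRoadSecantQuotientHasMover
import Summits.HodgeConjecture.HodgeConjecture.Theorems.VHCAbelianSchemesRoadSecondCarriedOfNodes
import Summits.HodgeConjecture.HodgeConjecture.Theorems.VHCAbelianSchemesRoadSecondCarriedOfTGRR
import Summits.HodgeConjecture.HodgeConjecture.Theorems.VHCAbelianSchemesRoadIsogenyPushforwardChernCharacterHolds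
import Summits.HodgeConjecture.HodgeConjecture.Theorems.VHCAbelianSchemesRoadPrintSheafHandleDefs
import Summits.HodgeConjecture.HodgeConjecture.Theorems.VHCAbelianSchemesRoadOffDiagonalSomeMoverOfPrintSheafHandle
import Summits.HodgeConjecture.HodgeConjecture.Theorems.VHCAbelianSchemesRoadSecantQuotientPinnedRigidityOfEndInt
import Literature.AlgebraicGeometry.Motives.AbelianVarietyManinMumfordRaynaud
import Summits.HodgeConjecture.HodgeConjecture.Theorems.VHCAbelianSchemesRoadMoverTrapDefs
import Summits.HodgeConjecture.HodgeConjecture.Theorems.VHCAbelianSchemesRoadMoverConfinementOfKSimpleHolds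
import Summits.HodgeConjecture.HodgeConjecture.Theorems.VHCAbelianSchemesRoadKSimpleOfEndTrivial
import Summits.HodgeConjecture.HodgeConjecture.Theorems.VHCAbelianSchemesRoadIsMoverTrapOfPsiStable
import Literature.AlgebraicGeometry.KTheory.EulerCharacteristic
import Summits.HodgeConjecture.HodgeConjecture.Theorems.VHCAbelianSchemesRoadNowhereDisplaceableDefs
import HarnessLib

/-!
# Road №4 (`VHCAbelianSchemesRoad`), crux stmt-HodgeConjecture-26512 `DiagLocalOfMarkmanPinnedForall` — lens line «negation», cycle 2
# (seat plan-lens-HodgeAV-26512-negation g2): **NOWHERE-DISPLACEABLE CARRIERS** — the obstruction shape behind ¬(S4), typed, and (S4) RE-CUT as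
# JUMP DESCENT along `q : J × Ĵ → Y` ∘ an UPSTAIRS PROPER-JUMP carrier (factor-agnostic, per PENCIL-26512-T12)

research route conditional on HC_CM; not a corollary; Q11.4-sentence-2 already refuted in dim ≥ 3.
NOTHING in this file says (S4) `stub_properJumpCarrierExists_End`, (c4a-E) `PrintSheafHandleExistsEnd`, the crux, №4, HC_AV, HC_CM or HC holds;
HC_CM HELD, by name only; typed ≠ proved; a displayed input is not progress. `sorry` occurs ONLY inside the four `stub_*` below.

REBASE v2 (LEAD ring2 165 = planner-pub-hodge-ring2-typer1-g163-0, 2026-08-28T22:32Z; director-hodge g17 R17.25 (3) ∕ R17.27 hand — the negation seat g2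
ended 22:23Z without posting «REBASING N′», so LEAD writes and the successor ∕ critic verifies bytes; idea-crit-6 g4 N2-7): the §0 OBJECTS `ProperJump`,
`DenseJump`, `denseJump_iff_not_properJump`, `quotientPullbackComplex`, `eulerPairingTranslate`, `EulerPairingTranslationInvariant` are RE-HOMED
byte-for-byte to the Theorems-lane brick `Summits/HodgeConjecture/HodgeConjecture/Theorems/VHCAbelianSchemesRoadNowhereDisplaceableDefs.lean` (core-w5 g4
p672648, commit ac09fbcdb476, sha16 70f984bb916af988; namespace `Summit.HodgeConjecture.HodgeConjecture.Ring2.SemiregularRepresentatives.NowhereDisplaceable`)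
and `open`ed here by name; v1's local copies (v1 = c9299650b742f1b3, l.107–150) are deleted; EVERY statement below — the four stubs (N-F) (N-I) (N-U) (N-E),
`properJumpCarrierExists_End_of_line`, `DiagLocalOfMarkmanPinnedForall_of` and all §1 ∕ §3 ∕ §4 theorems — is byte-unchanged; references «§0» ∕ «l.111» etc.
in the docstrings below refer to v1's numbering = the brick's bodies. Nothing is registered; the skeleton of record stays `Lines/birth.lean` v3.18.

TARGET. birth.lean v3.17 (b406f4390c6dcf4e) l.469 = `Lines/MoverTrap.lean` rev 2 (a47d61f3610d58ab) l.288, the line-N T3 designate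
(S4) `stub_properJumpCarrierExists_End`: at every End-trivial non-hyperelliptic H-good datum SOME `AdmTw′`-pinned datum of SOME pinned-served class
has its Ext-jump locus (off `1`) inside the `ℂ`-points of a PROPER closed subscheme of `Y` (`ProperJump`, §0).

THE NEGATION, TYPED (§1, sorry-free). ¬(S4) ⟺ at some End-trivial non-hyperelliptic H-good datum EVERY `AdmTw′`-pinned datum `𝓓` of EVERY
pinned-served class is NOWHERE DISPLACEABLE: its jump locus `J(𝓓.E) = {y | Ext^•(τ_y^*E, E) ≠ 0}` meets the complement of every proper closed
`V(ℂ) ∪ {1}` (`DenseJump`, `not_properJumpCarrierExists_iff_denseJump`). The one CERTIFICATE of nowhere-displaceability the theory offers is the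
EULER SELF-PAIRING: `χ(τ_y^*E, E) = Σ_k (−1)^k dim Ext^k(τ_y^*E, E)` is independent of `y` (a flat family over the connected base `Y`; EGA III 7.9.4 ∕
Riemann–Roch: `= ∫_Y ch(E^∨) ch(E) td_Y`, translations act trivially on `H^*(Y, ℚ)`), so `χ(E, E) ≠ 0 ⟹ J(E) = Y(ℂ)` (`extJumpLocus_eq_univ_of_eulerPairing`,
sorry-free over the displayed invariance (N-E)). For a 6-dimensional abelian variety and an `AdmTw′`-datum (`gluableSigmaAdmissible` forces the initial
segment `{1,…,6} ⊆ I`, so `κ(E) = (r, c₁θ, c₂θ², γ′ + c₃θ³, c₄θ⁴, c₅θ⁵, c₆θ⁶)` with `γ′ ∪ θ = 0` by the `σ ∕ σ̄`-bigrading of a served class) HRR gives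
`χ(E,E) = ∫_Y κ^∨κ = (2(r c₆ − c₁c₅ + c₂c₄) − c₃²)·∫θ⁶ − ∫γ′²`, and `−∫γ′² > 0` (Hodge–Riemann on primitive real (3,3)-classes). HENCE every (S4)-witness
satisfies the ISOTROPY IDENTITY `c₃² − 2(r c₆ − c₁c₅ + c₂c₄) = −∫γ′² ∕ ∫θ⁶ > 0` — a necessary numerical condition on the pinned data, checkable on
refute-markman's `κ(𝓔̄)` table (print passes: `χ(𝓔̄,𝓔̄) = χ(F₁,F₁)·χ(F₂,F₂)∕(d+1)² = 0·0` by Künneth and odd-dimensional antisymmetry on `J`). This is the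
lens's typed obstruction: «no handle» at a datum can only come from carriers with `χ(E,E) = 0` whose jump loci are nevertheless Zariski-dense — and for
such carriers NO invariant in the tree decides density (recorded dead ends: semicontinuity gives closedness only; Künneth boxes are the transfer seat's).
SORRY-FREE over (N-E) (§1): `isMoverTrap_of_qImageOff_id_subset` (everything off `1` is a mover trap — the LANDED S1 `MoverTrap.isMoverTrap_of_psiStable`,
p667854, at `B = J × Ĵ` itself), `eulerPairing_eq_zero_of_printSheafHandle` (EVERY print-sheaf handle has an Euler-isotropic carrier, `χ(𝓓.E, 𝓓.E) = 0`),
`isEmpty_printSheafHandle_of_forall_eulerPairing_ne_zero` (the only typed road from pinned data to «no handle», closed for print's isotropic class).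

THE RE-CUT OF (S4) (§2–§3). Write `q : P = J × Ĵ → Y = P∕Ḡ` (`D.q`) and `q^*E` (`quotientPullbackComplex`). Three displayed inputs:
* (N-F) `stub_extJumpLocus_lifts` — JUMPS LIFT: `q(p) ∈ J(E) ⟹ p ∈ J(q^*E)` (`τ_p^* q^* ≅ q^* τ_{q(p)}^*` since `q` is a homomorphism, and `q^*` is
  FAITHFUL on `Ext` because `𝒪_Y → q_*𝒪_P` splits off by the `Ḡ`-trace in characteristic 0). Derived-functor infrastructure; TRUE on paper; kernel XL
  (the tree has `q^*` on complexes but no `Ext`-functoriality for a non-endomorphism). [cite: Mukai1978, §3] [cite: MumfordAV1970, §7 Thm. 4 (p. 72)]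
* (N-I) `stub_properJump_of_confinedLifts` — IMAGES DESCEND: if every lift `p ∈ (J × Ĵ)(ℂ)` of every jump point of `E•` is `1` or lies in
  `V(ℂ)` for a closed `V ↪ J × Ĵ` with `V(ℂ) ≠ (J × Ĵ)(ℂ)`, then `ProperJump Y E•`: `J(E) ⊆ {1} ∪ q(V)(ℂ)`, `q(V)` closed (`q` finite) and `≠ Y`
  (`q⁻¹q(V) = ⋃_{g ∈ Ḡ} g·V` is a finite union of proper closed subsets of the irreducible `J × Ĵ`), `q` surjective on `ℂ`-points (the tree's
  `pointsMap_surjective`). Scheme-API node (scheme-theoretic image of a finite morphism, irreducibility); TRUE; kernel L. [cite: MumfordAV1970, §7 Thm. 4 (p. 72)]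
* (N-U) `stub_upstairsProperJumpCarrierExists_End` — THE OBJECT RESIDUE, FACTOR-AGNOSTIC: at every End-trivial non-hyperelliptic H-good datum some
  `AdmTw′`-pinned served `𝓓` on `Y` has `ProperJump (J × Ĵ) (q^*𝓓.E)` — the jump locus of the PULLED-BACK carrier is not Zariski-dense UPSTAIRS. For print's
  carrier `Ē` (`q^*Ē ≅ E ⊗ D^{−a}`, `E = 𝒢₁^*`, `𝒢 = Φ̃(F₂ ⊠ F₁)[−3]` the Orlov∕Fourier–Mukai image of a box of twisted ideal sheaves of curves in `J`,
  [Markman2025SecantWeil, §1.3 (p. 5), §9.3 Lemma 9.3.3, 9.3.5, Remark 9.3.7]): the dictionary (★★★) of PENCIL-26512-T12 §1 (Lemma 9.3.3 extended by Mukai's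
  exchange formula (3.1): `Ψ τ_{z,*} Ψ⁻¹ = 𝒫_{−z} ⊗`, `Ψ (L_b ⊗) Ψ⁻¹ = τ_{φ_Θ(b),*}`) writes `Ext_P(τ_y^*(E ⊗ N), E ⊗ N)`, `N = D^{−a}`, as a Künneth product of
  two FACTOR pieces with parameters `Λ₁(y), Λ₂(y)` AFFINE-LINEAR in `y` — so `J(q^*Ē) = Λ₁⁻¹(J₁) ∩ Λ₂⁻¹(J₂)` with `J₂ ⊊ J × J` closed and proper (T12 §5(a):
  the single-curve table of refute-markman W9 §1 (b) at ONE generic twist, `(0,k,k,0)` with `k = 0`) — PROPER upstairs, which is all (N-U) asks. NOT a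
  `pr_Ĵ`-confinement: the descent twist `N` has a non-zero `Ĵ`-slot component, which TRANSLATES factor 2 (T12 §3–§4; the pure-twist reading is the `z₂ = 0`
  slice of the non-descending `𝒢`), and `J₂ ⊇ J × {𝒪}` (T12 §5(b)) — so this line deliberately does NOT type a character. IN-HOUSE beyond print (print proves
  (C^∨) mover by mover, never a jump locus); research; XL; 0 provers until a director plates the object.
  [cite: Markman2025SecantWeil, §1.3 (p. 5), §9.3 Lemma 9.3.3, 9.3.5–9.3.6 and 9.3.11] [cite: Mukai1981, §3 (3.1)] [cite: Lange2023AbelianVarietiesComplex, Prop. 6.1.16 (p. 316)]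
Then `properJumpCarrierExists_End_of_line : (N-F) → (N-I) → (N-U) → (S4)` VERBATIM (sorry-free, three lines), `printSheafHandleExistsEnd_of_line :
Raynaud1983 → (N-F) → (N-I) → (N-U) → ∀ C, PrintSheafHandleExistsEnd C` through p664145's `printSheafHandleExistsEnd_of_stubs` with the LANDED S2
(`MoverTrap.moverConfinement_of_KSimple`, p667380) and S3 (`MoverTrap.kSimple_of_endTrivial`, p665569), and §4 the crux BY NAME (rev 2 §4 of
`Lines/MoverTrap.lean` transcribed over tree theorems; birth.lean NOT imported).

CONVERGENCE WITH LINE T (honest). Line T v2.0 (`Cruxes/…/TwistConfinedMoverFamily.lean`, transfer seat) confines the jumps through a finite GATE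
family `Λ` with torsion-sparse targets at ALL data (+ (MM2) proved); (N-U) asks only PROPERNESS of `J(q^*𝓓.E)` at END-TRIVIAL data and pays Raynaud on the
sixfold through the landed S2 (T12 §5(d): «LINE N's S2∘S3 mechanism read in factor coordinates; not lighter than S2»). So (N-U) is implied by T's gate
residue restricted to End-trivial data and is the WEAKEST object statement on the board; both are ONE sentence about print's carrier —
«`J(q^*Ē) ⊆ Λ₂⁻¹(J₂)`, `J₂ ⊊ J × J`» — read with different quantifiers. Recommendation to the LEAD: merge the object residues of N and T into that sentence.

NEGATIVE KNOWLEDGE honoured: S1 `MoverTrap.isMoverTrap_of_psiStable` (p667854: traps exist exactly along positive-dimensional `φ_d`-stable `B`, absent at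
End-trivial data by S3+S2); refute-markman W9 RESULT B (no fixed `m`; factor 1 is NOT a nondegenerate line bundle — both factors are twisted ideal sheaves,
and the descended carrier's factor-2 parameter is a twisted TRANSLATION — PENCIL-26512-T12 (75226505d26a549c) §1, §3–§5: hence (N-U) is typed
FACTOR-AGNOSTIC (proper jump upstairs), never as a `pr_Ĵ`-character); (P2) `pinnedCharacterRigidity_not_unconditional` (p645590) is not touched (no
character rigidity is used). No `Disproof.lean` is filed for this crux.

v3 (LEAD ring2 165, 2026-08-28T23:54Z; director-hodge g17 R17.69): §2b COMMENT-LEVEL (O₁) TARGET added below §2 — negation g3 TYPED print's object as the predicate `IsPrintCarrierTyping`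
(`O1Typing.lean` 55dee02cca3b9faa) and named the library debt (M1)–(M5); every clause MET ON PAPER at (6, 8) (O1ADM 3c3e88aa76faf880, O1SERVED ffd63c56b5994fab; idea-crit-6 g5 PASS as pencil);
CLASSIFICATION OF RECORD (R17.93): crux 26512 LIBRARY-BOUND. (N-F) `stub_extJumpLocus_lifts` is now a THEOREM in the Theorems lane (core-w5 g4 p677847) — NOT bound here: every statement
and proof of v2 (90448395a0403d43) is byte-identical in v3; the skeleton of record `Lines/birth.lean` v3.19 (38e33fb905161877) binds (S4) through it and registers (N-U). `sorry` count unchanged (4).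
-/

noncomputable section

open CategoryTheory CategoryTheory.Limits AlgebraicGeometry Topology

namespace Summit.HodgeConjecture.HodgeConjecture.Cruxes.DiagLocalOfMarkmanPinnedForall.NowhereDisplaceable

set_option linter.dupNamespace false

open Literature.AlgebraicGeometry Literature.AlgebraicGeometry.Motives Literature.AlgebraicGeometry.Motives.AbelianVariety
open Literature.AlgebraicGeometry.HodgeTheory Literature.AlgebraicGeometry.Markman2025
open Literature.AlgebraicGeometry.KTheory (IsBoundedVBComplex)
open Literature.AlgebraicTopology.SingularHomology
open Summit.HodgeConjecture.HodgeConjecture.Ring2.SemiregularRepresentatives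
open Summit.HodgeConjecture.HodgeConjecture.Ring2.SemiregularRepresentatives.MoverTrap
open Summit.HodgeConjecture.HodgeConjecture.Ring2.SemiregularRepresentatives.NowhereDisplaceable (ProperJump DenseJump denseJump_iff_not_properJump quotientPullbackComplex eulerPairingTranslate EulerPairingTranslationInvariant)
open Summit.HodgeConjecture.HodgeConjecture.Ring2.AbelianAll (carriedClasses)
open Literature.Barriers.HodgeConjecture (divisorClassesSpan)

/-! ## §1 Logic of the negation (sorry-free) -/

/-- (S4) reads: a `ProperJump` carrier at every End-trivial non-hyperelliptic H-good datum (definitional). [cite: Markman2025SecantWeil, §9.3 Lemma 9.3.11] -/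
theorem properJumpCarrierExists_End_iff :
    (∀ (C : ChernCharacterBetti) (D : SecantQuotientDatum) (θ₀ : complexBetti D.𝒥.J.X 2),
      ¬ D.𝒥.IsHyperelliptic → OrbitTranslatesDisjoint D.𝒥 D.G₁ D.G₂ → D.𝒥.J.IsPolarizationClassOf D.Θ θ₀ → EndTrivial D →
      ∃ γ ∈ secantQuotientServedClassesPinned D.Y.X (D.hY θ₀), ∃ 𝓓 : PinnedTwistedDatum C AdmTw' D.Y.X (D.hY θ₀) γ,
        ∃ (V : SchemeOver ℂ) (ι : V ⟶ D.Y.X), IsClosedImmersion ι.left ∧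
          Set.range (AlgPoints.map (L := ℂ) ι) ≠ Set.univ ∧
          extJumpLocus D.Y 𝓓.E ⊆ {1} ∪ Set.range (AlgPoints.map (L := ℂ) ι)) ↔
    ∀ (C : ChernCharacterBetti) (D : SecantQuotientDatum) (θ₀ : complexBetti D.𝒥.J.X 2),
      ¬ D.𝒥.IsHyperelliptic → OrbitTranslatesDisjoint D.𝒥 D.G₁ D.G₂ → D.𝒥.J.IsPolarizationClassOf D.Θ θ₀ → EndTrivial D →
      ∃ γ ∈ secantQuotientServedClassesPinned D.Y.X (D.hY θ₀), ∃ 𝓓 : PinnedTwistedDatum C AdmTw' D.Y.X (D.hY θ₀) γ,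
        ProperJump D.Y 𝓓.E :=
  Iff.rfl

/-- **THE TYPED COUNTEREXAMPLE SHAPE**: ¬(S4) ⟺ at some End-trivial non-hyperelliptic H-good datum every `AdmTw′`-pinned datum of every pinned-served class
is NOWHERE DISPLACEABLE. [cite: Markman2025SecantWeil, §9.3 Lemma 9.3.11] [cite: Mukai1978, §3] -/
theorem not_properJumpCarrierExists_End_iff_denseJump :
    (¬ ∀ (C : ChernCharacterBetti) (D : SecantQuotientDatum) (θ₀ : complexBetti D.𝒥.J.X 2),
      ¬ D.𝒥.IsHyperelliptic → OrbitTranslatesDisjoint D.𝒥 D.G₁ D.G₂ → D.𝒥.J.IsPolarizationClassOf D.Θ θ₀ → EndTrivial D →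
      ∃ γ ∈ secantQuotientServedClassesPinned D.Y.X (D.hY θ₀), ∃ 𝓓 : PinnedTwistedDatum C AdmTw' D.Y.X (D.hY θ₀) γ,
        ProperJump D.Y 𝓓.E) ↔
    ∃ (C : ChernCharacterBetti) (D : SecantQuotientDatum) (θ₀ : complexBetti D.𝒥.J.X 2),
      ¬ D.𝒥.IsHyperelliptic ∧ OrbitTranslatesDisjoint D.𝒥 D.G₁ D.G₂ ∧ D.𝒥.J.IsPolarizationClassOf D.Θ θ₀ ∧ EndTrivial D ∧
      ∀ γ ∈ secantQuotientServedClassesPinned D.Y.X (D.hY θ₀), ∀ 𝓓 : PinnedTwistedDatum C AdmTw' D.Y.X (D.hY θ₀) γ,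
        DenseJump D.Y 𝓓.E := by
  simp only [denseJump_iff_not_properJump]
  push Not
  rfl

/-- Off the jump locus every term of the Euler pairing vanishes. [cite: Mukai1978, §3] -/
theorem eulerPairingTranslate_eq_zero_of_not_mem {A : AbelianVariety ℂ} {E : CochainComplex A.X.left.Modules ℤ} {x : A.Points ℂ}
    (hx : x ∉ extJumpLocus A E) : eulerPairingTranslate A E x = 0 := by
  letI := HasDerivedCategory.standard A.X.left.Modules
  simp only [extJumpLocus, Set.mem_setOf_eq, not_exists, not_not] at hx
  unfold eulerPairingTranslate
  refine finsum_eq_zero_of_forall_eq_zero fun k => ?_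
  haveI : Subsingleton (DerivedCategory.Q.obj (translationPullbackComplex A x E) ⟶
      (shiftFunctor (DerivedCategory A.X.left.Modules) k).obj (DerivedCategory.Q.obj E)) := hx k
  rw [Module.finrank_zero_of_subsingleton, Nat.cast_zero, mul_zero]

/-- **THE EULER CERTIFICATE OF NOWHERE-DISPLACEABILITY**: if the Euler pairing is translation-invariant (N-E) and `χ(E•, E•) ≠ 0`, the Ext-jump locus is ALL of
`A(ℂ)`. For a 6-dimensional `Y` and an `AdmTw′`-pinned datum of a served class `γ′ + c₃θ³`, `χ(E,E) = (2(r c₆ − c₁c₅ + c₂c₄) − c₃²)∫θ⁶ − ∫γ′²` with `−∫γ′² > 0`: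
an (S4)-witness must satisfy `c₃² − 2(r c₆ − c₁c₅ + c₂c₄) = −∫γ′²∕∫θ⁶` (on paper; the necessary numerical condition this line hands to refute-markman).
[cite: MumfordAV1970, §5 Cor. (b) (p. 50) and §16 (Riemann–Roch)] [cite: Mukai1978, §3] -/
theorem extJumpLocus_eq_univ_of_eulerPairing {A : AbelianVariety ℂ} {E : CochainComplex A.X.left.Modules ℤ}
    (hinv : EulerPairingTranslationInvariant A E) (hne : eulerPairingTranslate A E 1 ≠ 0) : extJumpLocus A E = Set.univ := by
  refine Set.eq_univ_of_forall fun x => ?_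
  by_contra hx
  exact hne ((hinv x).symm.trans (eulerPairingTranslate_eq_zero_of_not_mem hx))

/-- … hence such a carrier is nowhere displaceable, granted only that `A(ℂ) ∖ {1}` is not the point set of a closed subscheme (the identity is not open;
displayed as `h1`). [cite: Mukai1978, §3] -/
theorem denseJump_of_eulerPairing {A : AbelianVariety ℂ} {E : CochainComplex A.X.left.Modules ℤ}
    (h1 : ∀ (V : SchemeOver ℂ) (ι : V ⟶ A.X), IsClosedImmersion ι.left →
      {1}ᶜ ⊆ Set.range (AlgPoints.map (L := ℂ) ι) → Set.range (AlgPoints.map (L := ℂ) ι) = Set.univ)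
    (hinv : EulerPairingTranslationInvariant A E) (hne : eulerPairingTranslate A E 1 ≠ 0) : DenseJump A E := by
  intro V ι hι hsub
  rw [extJumpLocus_eq_univ_of_eulerPairing hinv hne] at hsub
  refine h1 V ι hι fun x hx => ?_
  rcases hsub (Set.mem_univ x) with h | h
  · exact absurd h hx
  · exact h

/-- **EVERYTHING OFF THE IDENTITY IS A MOVER TRAP** — from the LANDED S1 `MoverTrap.isMoverTrap_of_psiStable` (p667854) at `B = J × Ĵ` itself (`f = 𝟙`,
`ψ_B = φ_d`, `dim = 6 > 0`): `qImageOff D 𝟙 = Y(ℂ) ∖ {1}` is a trap, hence so is every set containing it. Sorry-free. [cite: Markman2025SecantWeil, §9.3 Lemma 9.3.3] -/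
theorem isMoverTrap_of_qImageOff_id_subset (D : SecantQuotientDatum) {S : Set (D.Y.Points ℂ)} (hS : qImageOff D (𝟙 D.P) ⊆ S) :
    IsMoverTrap D S := by
  have hid : IsClosedImmersion (Hom.toSchemeHom (𝟙 D.P)) := by
    change IsClosedImmersion (𝟙 D.P.X.left)
    infer_instance
  exact (isMoverTrap_of_psiStable D D.P (𝟙 D.P) hid ⟨D.ψ, by rw [Category.comp_id, Category.id_comp]⟩ (by rw [D.dim_P]; norm_num)).mono hS

/-- In particular a carrier whose Ext-jump locus is ALL of `Y(ℂ)` is trapped. [cite: Markman2025SecantWeil, §9.3 Lemma 9.3.3] -/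
theorem isMoverTrap_of_extJumpLocus_eq_univ (D : SecantQuotientDatum) {E : CochainComplex D.Y.X.left.Modules ℤ}
    (hJ : extJumpLocus D.Y E = Set.univ) : IsMoverTrap D (extJumpLocus D.Y E) :=
  isMoverTrap_of_qImageOff_id_subset D (hJ ▸ Set.subset_univ _)

/-- **THE TYPED OBSTRUCTION OF THE LENS: EVERY PRINT-SHEAF HANDLE HAS AN EULER-ISOTROPIC CARRIER**, `χ(𝓓.E, 𝓓.E) = 0` — granted only the
translation-invariance (N-E) of the Euler pairing. (A carrier with `χ ≠ 0` jumps everywhere, so EVERY mover kernel point `≠ 1` violates (C^∨): the landed S1 at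
`B = J × Ĵ`.) Consequently «no handle at a datum» (¬(c4a) there) can only be witnessed inside the isotropic quadric `{χ(E,E) = 0}` of `AdmTw′`-pinned served
carriers; on it, NO invariant in the tree decides Zariski-density of the jump locus — the honest residue is the object statement (N-U). For `dim Y = 6` and
`κ = (r, c₁θ, c₂θ², γ′ + c₃θ³, c₄θ⁴, c₅θ⁵, c₆θ⁶)`: `χ = (2(r c₆ − c₁c₅ + c₂c₄) − c₃²)∫θ⁶ − ∫γ′²` (HRR; `γ′ ∪ θ = 0`), so a handle needs
`c₃² − 2(r c₆ − c₁c₅ + c₂c₄) = −∫γ′²∕∫θ⁶ > 0` — print's `𝓔̄` passes (`χ = χ(F₁,F₁)χ(F₂,F₂)∕(d+1)² = 0`). Sorry-free over (N-E).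
[cite: Markman2025SecantWeil, §9.3 Lemma 9.3.3 and Lemma 9.3.11] [cite: MumfordAV1970, §5 Cor. (b) (p. 50) and §16] [cite: Mukai1978, §3] -/
theorem eulerPairing_eq_zero_of_printSheafHandle
    (hNE : ∀ (A : AbelianVariety ℂ) (E : CochainComplex A.X.left.Modules ℤ), IsBoundedVBComplex E → EulerPairingTranslationInvariant A E)
    {C : ChernCharacterBetti} {D : SecantQuotientDatum} {θ₀ : complexBetti D.𝒥.J.X 2} (H : D.PrintSheafHandle C θ₀) :
    eulerPairingTranslate D.Y H.datum.E 1 = 0 := by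
  by_contra hne
  exact not_isMoverTrap_extJumpLocus_of_printSheafHandle H
    (isMoverTrap_of_extJumpLocus_eq_univ D (extJumpLocus_eq_univ_of_eulerPairing (hNE D.Y H.datum.E H.datum.bounded) hne))

/-- … and dually: at a datum where EVERY `AdmTw′`-pinned served carrier has `χ(E,E) ≠ 0`, NO handle exists — the only typed road from pinned data to ¬(c4a),
and it is closed for print's class (isotropic). [cite: Markman2025SecantWeil, §9.3 Lemma 9.3.11] [cite: Mukai1978, §3] -/
theorem isEmpty_printSheafHandle_of_forall_eulerPairing_ne_zero
    (hNE : ∀ (A : AbelianVariety ℂ) (E : CochainComplex A.X.left.Modules ℤ), IsBoundedVBComplex E → EulerPairingTranslationInvariant A E)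
    {C : ChernCharacterBetti} {D : SecantQuotientDatum} {θ₀ : complexBetti D.𝒥.J.X 2}
    (hall : ∀ γ ∈ secantQuotientServedClassesPinned D.Y.X (D.hY θ₀), ∀ 𝓓 : PinnedTwistedDatum C AdmTw' D.Y.X (D.hY θ₀) γ,
      eulerPairingTranslate D.Y 𝓓.E 1 ≠ 0) :
    IsEmpty (D.PrintSheafHandle C θ₀) :=
  ⟨fun H => hall H.γ H.served H.datum (eulerPairing_eq_zero_of_printSheafHandle hNE H)⟩

/-- **JUMP DESCENT, LOGIC ONLY**: if jumps lift along `q` (N-F at `E•`) and the jump locus of `q^*E•` lies in `{1} ∪ V(ℂ)` (the matrix of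
`ProperJump (J × Ĵ) (q^*E•)`), the hypothesis of (N-I) holds. [cite: MumfordAV1970, §7 Thm. 4 (p. 72)] -/
theorem confinedLifts_of_lifts_of_upstairs {D : SecantQuotientDatum} {E : CochainComplex D.Y.X.left.Modules ℤ}
    (hF : ∀ p : D.P.Points ℂ, AlgPoints.map D.q.hom.hom.hom p ∈ extJumpLocus D.Y E → p ∈ extJumpLocus D.P (quotientPullbackComplex D E))
    {V : SchemeOver ℂ} {ι : V ⟶ D.P.X}
    (hconf : extJumpLocus D.P (quotientPullbackComplex D E) ⊆ {1} ∪ Set.range (AlgPoints.map (L := ℂ) ι)) :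
    ∀ p : D.P.Points ℂ, AlgPoints.map D.q.hom.hom.hom p ∈ extJumpLocus D.Y E → p = 1 ∨ p ∈ Set.range (AlgPoints.map (L := ℂ) ι) :=
  fun p hp => by simpa only [Set.mem_union, Set.mem_singleton_iff] using hconf (hF p hp)

/-! ## §2 The line's displayed inputs (registered stubs; `sorry` ONLY here) -/

/-- STUB (N-F) — **JUMPS LIFT ALONG `q`**: `q(p) ∈ J(E•) ⟹ p ∈ J(q^*E•)`. On paper: `τ_p^* q^* ≅ q^* τ_{q(p)}^*` (`q ∘ τ_p = τ_{q(p)} ∘ q`) and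
`q^* : Ext_Y^k(A, B) → Ext_P^k(q^*A, q^*B)` is injective for bounded complexes of vector bundles (`Hom_P(q^*A, q^*B⟦k⟧) = Hom_Y(A, B ⊗ q_*𝒪_P⟦k⟧)` and
`𝒪_Y → q_*𝒪_P` is split by `(1∕|Ḡ|)·trace`). Derived-functor INFRASTRUCTURE (object-free, `Φ`-free); TRUE; kernel XL — the tree types `q^*` on complexes
but has no `Ext`-functoriality along a non-endomorphism (cf. `IsogenyDerivedAdjointPairExists`, endomorphisms only). Why it might fail: only by a typing
artefact of `HasDerivedCategory.standard` on ALL `𝒪`-modules (none expected). Characters `χ ∈ Ḡ^D ↔` line bundles `L_χ` on `Y` with `q^*L_χ ≅ 𝒪`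
(`Ker q̂ ≅ Ker(q)^D`), `q_*𝒪_P ≅ ⊕_χ L_χ`. [cite: Mukai1978, §3] [cite: MumfordAV1970, §7 Thm. 4 (p. 72)] [cite: GortzWedhorn2023, Prop. 27.213 (3) (p. 903)] -/
theorem stub_extJumpLocus_lifts :
    ∀ (D : SecantQuotientDatum) (E : CochainComplex D.Y.X.left.Modules ℤ), IsBoundedVBComplex E →
      ∀ p : D.P.Points ℂ, AlgPoints.map D.q.hom.hom.hom p ∈ extJumpLocus D.Y E →
        p ∈ extJumpLocus D.P (quotientPullbackComplex D E) := by
  sorry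

/-- STUB (N-I) — **CONFINED LIFTS GIVE A PROPER JUMP DOWNSTAIRS**: if every `p ∈ (J × Ĵ)(ℂ)` over a jump point of `E•` is `1` or lies in `V(ℂ)` for a
closed `V ↪ J × Ĵ` with `V(ℂ) ≠ (J × Ĵ)(ℂ)`, then `ProperJump Y E•`: take the scheme-theoretic image `q(V) ↪ Y` of the finite `q` (closed), use that `q` is
surjective on `ℂ`-points (tree: `pointsMap_surjective`) for `J(E) ⊆ {1} ∪ q(V)(ℂ)`, and `q(V) ≠ Y` because `q⁻¹(q(V)) = ⋃_{g ∈ Ḡ} g·V` is a finite union of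
proper closed subsets of the IRREDUCIBLE `J × Ĵ`. Scheme-API node; TRUE; kernel L (image of a finite morphism, irreducibility of an abelian variety,
`Ḡ`-saturation). Why it might fail: it cannot on paper; the risk is API cost only.
[cite: MumfordAV1970, §7 Thm. 4 (p. 72)] [cite: GortzWedhorn2020, §12.13 (3) and Prop. 12.58 (p. 434)] -/
theorem stub_properJump_of_confinedLifts :
    ∀ (D : SecantQuotientDatum) (E : CochainComplex D.Y.X.left.Modules ℤ)
      (V : SchemeOver ℂ) (ι : V ⟶ D.P.X), IsClosedImmersion ι.left →
      Set.range (AlgPoints.map (L := ℂ) ι) ≠ Set.univ →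
      (∀ p : D.P.Points ℂ, AlgPoints.map D.q.hom.hom.hom p ∈ extJumpLocus D.Y E → p = 1 ∨ p ∈ Set.range (AlgPoints.map (L := ℂ) ι)) →
      ProperJump D.Y E := by
  sorry

/-- STUB (N-U) — **THE OBJECT RESIDUE, FACTOR-AGNOSTIC: AN UPSTAIRS PROPER-JUMP CARRIER AT EVERY END-TRIVIAL NON-HYPERELLIPTIC H-GOOD DATUM** —
some `AdmTw′`-pinned served `𝓓` on `Y` whose pulled-back carrier `q^*𝓓.E` has a NON-DENSE Ext-jump locus on `J × Ĵ`. For print's `Ē` (`q^*Ē ≅ E ⊗ D^{−a}`,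
`E = 𝒢₁^*`, `𝒢 = Φ̃(F₂ ⊠ F₁)[−3]`): by the dictionary (★★★) of PENCIL-26512-T12 §1 (Markman's Lemma 9.3.3 + Mukai's exchange (3.1)) the `y`-translate self-Ext of
`E ⊗ N` is a Künneth product of two factor pieces at parameters `Λ₁(y), Λ₂(y)` affine-linear in `y`, so `J(q^*Ē) = Λ₁⁻¹(J₁) ∩ Λ₂⁻¹(J₂) ⊆ Λ₂⁻¹(J₂)` with
`J₂ = {(z, M) | Ext^•_J(I_{𝒵₂+z} ⊗ M, I_{𝒵₂}) ≠ 0} ⊊ J × J` closed and PROPER (T12 §5(a): refute-markman W9 §1 (b)'s single-curve table at one generic twist).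
Deliberately NOT typed as a `pr_Ĵ`-character: the descent twist translates factor 2 (T12 §3–§4) and `J₂ ⊇ J × {𝒪}` (T12 §5(b)). IN-HOUSE BEYOND PRINT
(print proves (C^∨) mover by mover, never the jump locus); research; XL (the object is not in the tree); 0 provers until plated. Why it might fail: through
O₁ only — `Ē`'s resolution failing the TYPED `AdmTw′` or print's class failing `secantQuotientServedClassesPinned` at some End-trivial datum; or `Λ₂` failing
to be dominant for the chosen normalisation `a` (T12 §4(iv): avoidable by the choice of `a`).
[cite: Markman2025SecantWeil, §1.3 (p. 5), §9.3 Lemma 9.3.3, 9.3.5–9.3.6, Remark 9.3.7 and Lemma 9.3.11] [cite: Mukai1981, §3 (3.1)]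
[cite: Lange2023AbelianVarietiesComplex, Prop. 6.1.16 (p. 316)] [cite: Mukai1978, §3] -/
theorem stub_upstairsProperJumpCarrierExists_End :
    ∀ (C : ChernCharacterBetti) (D : SecantQuotientDatum) (θ₀ : complexBetti D.𝒥.J.X 2),
      ¬ D.𝒥.IsHyperelliptic → OrbitTranslatesDisjoint D.𝒥 D.G₁ D.G₂ → D.𝒥.J.IsPolarizationClassOf D.Θ θ₀ → EndTrivial D →
      ∃ γ ∈ secantQuotientServedClassesPinned D.Y.X (D.hY θ₀), ∃ 𝓓 : PinnedTwistedDatum C AdmTw' D.Y.X (D.hY θ₀) γ,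
        ProperJump D.P (quotientPullbackComplex D 𝓓.E) := by
  sorry

/-- STUB (N-E) — **NEGATIVE SIDE: THE EULER PAIRING IS TRANSLATION-INVARIANT** for a bounded complex of vector bundles on an abelian variety (`χ` is constant
in the flat family `{τ_x^*E•}_{x ∈ A}` over the connected base; equivalently Riemann–Roch `χ(τ_x^*E, E) = ∫ ch(E^∨)ch(E)td_A`, translations acting trivially on
`H^*(A, ℚ)`). Not in (S4)'s cone (it serves the counterexample side, like S1). Derived ∕ cohomological INFRASTRUCTURE; TRUE; kernel XL. Why it might fail: only via the
junk conventions (`finrank` of an infinite-dimensional space, `finsum` of an infinite support) — excluded for bounded complexes of vector bundles on a proper scheme, on paper.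
[cite: MumfordAV1970, §5 Cor. (b) (p. 50) and §16] [cite: Hartshorne1977, III Thm. 9.9 and Thm. 12.8] -/
theorem stub_eulerPairingTranslationInvariant :
    ∀ (A : AbelianVariety ℂ) (E : CochainComplex A.X.left.Modules ℤ), IsBoundedVBComplex E → EulerPairingTranslationInvariant A E := by
  sorry

/-! ## §2b COMMENT-LEVEL TARGET for the closer of (N-U) — the (O₁) typing and the library debt (director-hodge g17 R17.69; NOT a stub of record, nothing registered, nothing declared)

negation g3 (plan-lens-HodgeAV-26512-negation g3) TYPED print's object as a PREDICATE on the object — `Cruxes/DiagLocalOfMarkmanPinnedForall/O1Typing.lean` (commit 887d4f71b3c7,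
sha16 55dee02cca3b9faa, farm rc 0 · 0 sorry; namespace `…Cruxes.DiagLocalOfMarkmanPinnedForall.NowhereDisplaceable.TwoTorsion`), verbatim (l.45–47 there):

    def IsPrintCarrierTyping (C : ChernCharacterBetti) (D : SecantQuotientDatum) (θ₀ : complexBetti D.𝒥.J.X 2)
        (E : CochainComplex D.Y.X.left.Modules ℤ) : Prop :=
      ∃ γ ∈ secantQuotientServedClassesPinned D.Y.X (D.hY θ₀), ∃ 𝓓 : PinnedTwistedDatum C AdmTw' D.Y.X (D.hY θ₀) γ, 𝓓.E = E

so that (N-U) `stub_upstairsProperJumpCarrierExists_End` above reads, after its four hypotheses, «∃ E, IsPrintCarrierTyping C D θ₀ E ∧ ProperJump D.P (quotientPullbackComplex D E)»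
(up to the order of the existentials), and the runnable form `isPrintCarrierTyping_iff` (same file) splits (O₁)(E) into separately attackable clauses [O₁-served] · [O₁-B] · [O₁-adm] ·
[O₁-κ] · the I-clause; `typedCarrierNonJumpingEnd_iff_oneNonJumpingPoint` records the honest caveat that over existing declarations «∃ E, (O₁)(E) ∧ a non-jumping point» is
literally (N-U♭). THE CLOSED FORM (O₁)(Ē_{a′}) — print's descended sheaf itself as a term — is NOT typable tonight: that is the library debt below.

LEDGER OF RECORD at (d, a′) = (6, 8) (director-hodge g17 R17.80 ∕ R17.89 ∕ R17.90 ∕ R17.93; idea-crit-6 g5 prices on the HOME bus l.6000 ∕ l.6004): EVERY CLAUSE of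
`isPrintCarrierTyping_iff` is MET ON PAPER for print's Ē₈ — [O₁-B] typed (O1Typing) · [O₁-adm] through the disjunct `gluableSigmaAdmissible` by a bounded locally free resolution
(memo `PENCIL-26512-O1ADM.md` 3c3e88aa76faf880; crit PASS as pencil, P1 «clean because the typed component set is the full initial segment {0,…,5}», P2 «needs a bounded
finite-locally-free resolution E• of Ē₈ with termwise hE» = library; rider: `bfSingleAdmissible'` is NOT met, Ē₈ being reflexive but not locally free) · [O₁-served] with the
canonical witness (D, Iso.refl, θ₀) and γ := the Hodge–Weil projection of κ₃(Ē₈) (memo `PENCIL-26512-O1SERVED.md` ffd63c56b5994fab; crit PASS as pencil) · [O₁-κ] in print ·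
3 ∈ I by choice; the residue is Lean identification, not mathematics: (g1) `sigmaC` = the Buchweitz–Flenner σ_q, (g4) `D.hY θ₀` = the descent of print's h, (g5), (g6)
`ChernCharacterBetti` = ch. NEGATION-LENS CONCLUSION (R17.90): no forced obstruction to (N-U) at (6, 8) from the object side — a counterexample, if any, must come from the
PROPERNESS ∕ jump clause (refute-markman g8's properness-side plate is the one live falsifier). CLASSIFICATION OF RECORD (R17.93): crux 26512 is LIBRARY-BOUND —
«complete on paper» is pencil-grade, not risk-free; a kernel proof of (N-U) lacks the following LIBRARY (plus the un-kerneled properness leg, T12 ∕ T13 ⟷ N22 on paper):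
  (M1) the Poincaré ∕ Fourier–Mukai–Orlov equivalence Φ̃ on bounded complexes over J × Ĵ (the tree has only the analytic
       `Literature/Geometry/Kaehler/ComplexTorusPoincareBundle.poincareBundle` and `…PicardPoincareUniversal`; no scheme-side dual abelian variety, φ_L or Fourier–Mukai);
  (M2) the ideal sheaf of a disjoint union of Abel–Jacobi translates of C as an 𝒪_J-module;
  (M3) the external tensor product ⊠ of bounded complexes;
  (M4) the determinant line bundle of a bounded complex, with φ_L;
  (M5) Ḡ-equivariant DESCENT along the free quotient q : J × Ĵ → Y — (M5)-lite in progress at core-w5 g4: p678293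
       `Literature/AlgebraicGeometry/Modules/PullbackPushforwardGroupAction.lean` (`twistAction`; chart formula act_x(c·η(m)) = σ_x(c)·η(m); `pullbackUnit_comp_twistAction`),
       p678930 `Literature/AlgebraicGeometry/Modules/PullbackPushforwardDescentChart.lean` (invariant sections of f_* f^* M over a FRAMED Galois chart are η of a unique section:
       `exists_unitSection_eq_of_twistAction_invariant`, `unitSection_injective_of_frame`); remaining, named by core-w5: (i) invariants of an invariant localisation for a
       finite group, (ii) gluing over the basis of framed Galois principal opens, (iii) the instance q : J × Ĵ → Y over `exists_galoisChart_kerTranslation`.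
ALSO OF RECORD for this line: (N-F) `stub_extJumpLocus_lifts` (§2 above, l.239–242) is now a THEOREM — `Summit.HodgeConjecture.HodgeConjecture.Ring2.SemiregularRepresentatives.NowhereDisplaceable.extJumpLocus_lifts`
(core-w5 g4 p677847 `Theorems/VHCAbelianSchemesRoadExtJumpLocusLifts.lean`, commit 4a46f5e854a9; statement byte-identical to l.240–242; std axioms) over the trace retraction (R)
(p675063 `Literature/Algebra/Homology/RetractOfNaturalRetraction.lean`, p675723 `Literature/AlgebraicGeometry/Modules/PullbackPushforwardTraceChart.lean`, p676770
`Literature/AlgebraicGeometry/Modules/PullbackPushforwardTraceRetraction.lean`) and (R) → (N-F) p674291; (N-I) `stub_properJump_of_confinedLifts` is the THEOREM p673373. Neither is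
bound in this WORKFILE (v3 keeps every v2 statement and proof byte-identical; the binding of record lives in the skeleton `Lines/birth.lean` v3.19, sha16 38e33fb905161877, where
(S4) := `properJumpCarrierExists_End_of_line extJumpLocus_lifts properJump_of_confinedLifts stub_upstairsProperJumpCarrierExists_End` and (N-U) is the registered T3 designate).
TYPER BRIEF OF RECORD for the requested seat req-55 (director-hodge g17 R17.99 + addendum): N′ card `Lines/NowhereDisplaceable.md` rev 6.1 (commit 1e6cd3040e53, sha16 904241365d38cef3)
§ «Library debt (M1)–(M5) — TYPING SPEC» with crit P1 ∕ P2 folded; ORDER ADOPTED M4 → M2 → M3 → M5 → M1 ((M4) = the cheapest enabler: `KZero.det (eulerChar E hE) : CechPic X` is already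
composable, the one missing input being the theorem of the square in CechPic form); plus core-w5 g4's (M5)-lite HANDOFF. Nothing in this comment is a statement of record; nothing here says (N-U), (O₁)(E) for any E in the kernel, (M5), any stub, the crux, №4, HC_AV
or HC holds; pencil ≠ kernel; typed ≠ proved. research route conditional on HC_CM; not a corollary; Q11.4-sentence-2 already refuted in dim ≥ 3. -/

/-! ## §3 Compositions (sorry-free given the displayed inputs) -/

/-- **(S4) FROM THE RE-CUT**: `(N-F) → (N-I) → (N-U) → (S4)` VERBATIM (birth.lean v3.17 l.469 ∕ `Lines/MoverTrap.lean` rev 2 l.288, over p664145's vocabulary).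
[cite: Markman2025SecantWeil, §9.3 Lemma 9.3.11] [cite: Mukai1978, §3] -/
theorem properJumpCarrierExists_End_of_line
    (hF : ∀ (D : SecantQuotientDatum) (E : CochainComplex D.Y.X.left.Modules ℤ), IsBoundedVBComplex E →
      ∀ p : D.P.Points ℂ, AlgPoints.map D.q.hom.hom.hom p ∈ extJumpLocus D.Y E → p ∈ extJumpLocus D.P (quotientPullbackComplex D E))
    (hI : ∀ (D : SecantQuotientDatum) (E : CochainComplex D.Y.X.left.Modules ℤ)
      (V : SchemeOver ℂ) (ι : V ⟶ D.P.X), IsClosedImmersion ι.left →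
      Set.range (AlgPoints.map (L := ℂ) ι) ≠ Set.univ →
      (∀ p : D.P.Points ℂ, AlgPoints.map D.q.hom.hom.hom p ∈ extJumpLocus D.Y E → p = 1 ∨ p ∈ Set.range (AlgPoints.map (L := ℂ) ι)) →
      ProperJump D.Y E)
    (hU : ∀ (C : ChernCharacterBetti) (D : SecantQuotientDatum) (θ₀ : complexBetti D.𝒥.J.X 2),
      ¬ D.𝒥.IsHyperelliptic → OrbitTranslatesDisjoint D.𝒥 D.G₁ D.G₂ → D.𝒥.J.IsPolarizationClassOf D.Θ θ₀ → EndTrivial D →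
      ∃ γ ∈ secantQuotientServedClassesPinned D.Y.X (D.hY θ₀), ∃ 𝓓 : PinnedTwistedDatum C AdmTw' D.Y.X (D.hY θ₀) γ,
        ProperJump D.P (quotientPullbackComplex D 𝓓.E)) :
    ∀ (C : ChernCharacterBetti) (D : SecantQuotientDatum) (θ₀ : complexBetti D.𝒥.J.X 2),
      ¬ D.𝒥.IsHyperelliptic → OrbitTranslatesDisjoint D.𝒥 D.G₁ D.G₂ → D.𝒥.J.IsPolarizationClassOf D.Θ θ₀ → EndTrivial D →
      ∃ γ ∈ secantQuotientServedClassesPinned D.Y.X (D.hY θ₀), ∃ 𝓓 : PinnedTwistedDatum C AdmTw' D.Y.X (D.hY θ₀) γ,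
        ∃ (V : SchemeOver ℂ) (ι : V ⟶ D.Y.X), IsClosedImmersion ι.left ∧
          Set.range (AlgPoints.map (L := ℂ) ι) ≠ Set.univ ∧
          extJumpLocus D.Y 𝓓.E ⊆ {1} ∪ Set.range (AlgPoints.map (L := ℂ) ι) := by
  intro C D θ₀ hnh hH hθ₀ hEnd
  obtain ⟨γ, hγ, 𝓓, V, ι, hι, hV, hconf⟩ := hU C D θ₀ hnh hH hθ₀ hEnd
  exact ⟨γ, hγ, 𝓓, hI D 𝓓.E V ι hι hV (confinedLifts_of_lifts_of_upstairs (hF D 𝓓.E 𝓓.bounded) hconf)⟩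

/-- **(c4a-E) FROM THE RE-CUT** — `Raynaud1983 → (N-F) → (N-I) → (N-U) → ∀ C, PrintSheafHandleExistsEnd C`, through p664145's `printSheafHandleExistsEnd_of_stubs`
with the LANDED S2 `MoverTrap.moverConfinement_of_KSimple` (p667380) and S3 `MoverTrap.kSimple_of_endTrivial` (p665569) BY NAME.
[cite: Raynaud1983SousVarietes, Théorème principal (p. 327)] [cite: Markman2025SecantWeil, §9.3 Lemma 9.3.11] -/
theorem printSheafHandleExistsEnd_of_line (hR : Raynaud1983_maninMumford)
    (hF : ∀ (D : SecantQuotientDatum) (E : CochainComplex D.Y.X.left.Modules ℤ), IsBoundedVBComplex E →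
      ∀ p : D.P.Points ℂ, AlgPoints.map D.q.hom.hom.hom p ∈ extJumpLocus D.Y E → p ∈ extJumpLocus D.P (quotientPullbackComplex D E))
    (hI : ∀ (D : SecantQuotientDatum) (E : CochainComplex D.Y.X.left.Modules ℤ)
      (V : SchemeOver ℂ) (ι : V ⟶ D.P.X), IsClosedImmersion ι.left →
      Set.range (AlgPoints.map (L := ℂ) ι) ≠ Set.univ →
      (∀ p : D.P.Points ℂ, AlgPoints.map D.q.hom.hom.hom p ∈ extJumpLocus D.Y E → p = 1 ∨ p ∈ Set.range (AlgPoints.map (L := ℂ) ι)) →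
      ProperJump D.Y E)
    (hU : ∀ (C : ChernCharacterBetti) (D : SecantQuotientDatum) (θ₀ : complexBetti D.𝒥.J.X 2),
      ¬ D.𝒥.IsHyperelliptic → OrbitTranslatesDisjoint D.𝒥 D.G₁ D.G₂ → D.𝒥.J.IsPolarizationClassOf D.Θ θ₀ → EndTrivial D →
      ∃ γ ∈ secantQuotientServedClassesPinned D.Y.X (D.hY θ₀), ∃ 𝓓 : PinnedTwistedDatum C AdmTw' D.Y.X (D.hY θ₀) γ,
        ProperJump D.P (quotientPullbackComplex D 𝓓.E)) :
    ∀ C : ChernCharacterBetti, PrintSheafHandleExistsEnd C :=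
  printSheafHandleExistsEnd_of_stubs hR moverConfinement_of_KSimple kSimple_of_endTrivial (properJumpCarrierExists_End_of_line hF hI hU)

/-- **(S4) FROM THE REGISTERED STUBS** (the line's `_of` for the target node; `sorryAx` only through `stub_extJumpLocus_lifts`, `stub_properJump_of_confinedLifts`,
`stub_upstairsProperJumpCarrierExists_End`). [cite: Markman2025SecantWeil, §9.3 Lemma 9.3.11] -/
theorem properJumpCarrierExists_End_of :
    ∀ (C : ChernCharacterBetti) (D : SecantQuotientDatum) (θ₀ : complexBetti D.𝒥.J.X 2),
      ¬ D.𝒥.IsHyperelliptic → OrbitTranslatesDisjoint D.𝒥 D.G₁ D.G₂ → D.𝒥.J.IsPolarizationClassOf D.Θ θ₀ → EndTrivial D →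
      ∃ γ ∈ secantQuotientServedClassesPinned D.Y.X (D.hY θ₀), ∃ 𝓓 : PinnedTwistedDatum C AdmTw' D.Y.X (D.hY θ₀) γ,
        ∃ (V : SchemeOver ℂ) (ι : V ⟶ D.Y.X), IsClosedImmersion ι.left ∧
          Set.range (AlgPoints.map (L := ℂ) ι) ≠ Set.univ ∧
          extJumpLocus D.Y 𝓓.E ⊆ {1} ∪ Set.range (AlgPoints.map (L := ℂ) ι) :=
  properJumpCarrierExists_End_of_line stub_extJumpLocus_lifts stub_properJump_of_confinedLifts stub_upstairsProperJumpCarrierExists_End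

/-- (c4a-E) from the registered stubs. [cite: Raynaud1983SousVarietes, Théorème principal (p. 327)] -/
theorem printSheafHandleExistsEnd_of (hR : Raynaud1983_maninMumford) : ∀ C : ChernCharacterBetti, PrintSheafHandleExistsEnd C :=
  printSheafHandleExistsEnd_of_line hR stub_extJumpLocus_lifts stub_properJump_of_confinedLifts stub_upstairsProperJumpCarrierExists_End

/-! ## §4 The CRUX BY NAME — `Lines/MoverTrap.lean` rev 2 §4 transcribed over tree modules (birth.lean NOT imported; `h₁` = 1′, `hT` = (c1) (bound in birth v3.13ff),
`h₂ᵣ` = 2r″, `h₃` = 3′ᴸ by STATEMENT; (c2), (c3″) the tree theorems birth binds; (c4a) ∕ (c4) replaced by `printSheafHandleExistsEnd_of` ∘ p664145's (c4-E)) -/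

section CruxByName

/-- The route's End-keyed anchor presentation predicate (v3.12 oHE), abbreviated. [cite: Markman2025SecantWeil, Thm. 1.4.1 («generic»)] -/
abbrev offHypDisjEndAnchors : (Y : SchemeOver ℂ) → complexBetti Y 2 → Prop :=
  fun Y θ ↦ secantQuotientAnchorsPinned Y θ ∧ ∃ (D : SecantQuotientDatum) (e : Y ≅ D.Y.X) (θ₀ : complexBetti D.𝒥.J.X 2),
    ¬ D.𝒥.IsHyperelliptic ∧ OrbitTranslatesDisjoint D.𝒥 D.G₁ D.G₂ ∧ D.𝒥.J.IsPolarizationClassOf D.Θ θ₀ ∧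
    (∀ f : D.𝒥.J ⟶ D.𝒥.J, ∃ n : ℤ, f = n • 𝟙 D.𝒥.J) ∧ complexBetti.map e.inv 2 θ = D.hY θ₀

/-- The pinned-served classes plus the `θ³`-line, abbreviated (birth's third family argument). [cite: Markman2025SecantWeil, Thm. 1.4.1 (item 4)] -/
abbrev servedPlusTheta : (Y : SchemeOver ℂ) → complexBetti Y 2 → Set (complexBetti Y (2 * 3)) :=
  fun Y θ ↦ {w | ∃ γ, (γ = 0 ∨ γ ∈ secantQuotientServedClassesPinned Y θ) ∧ ∃ z : ℂ, w = γ + z • cupPowTwo θ 3}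

/-- **ONE CARRIED CLASS from `hL` alone** (birth.lean `exists_carried_pinned_of_presentedOffHypDisj_of_pinnedForall`, transcribed; tree theorems only).
[cite: Markman2025SecantWeil, §1.5 (p. 7), Thm. 1.4.1 (item 4), §9.1 (p. 57) and §9.3 Lemma 9.3.11] -/
theorem exists_carried_pinned_of_presentedOffHypDisj_of_pinnedForall' {C : ChernCharacterBetti}
    (hLC : Markman2025_secantQuotient_twistedCarrier_onJacobian_pinnedForall C AdmTw')
    {X : SchemeOver ℂ} {θ : complexBetti X 2}
    (hpres : ∃ (D : SecantQuotientDatum) (e : X ≅ D.Y.X) (θ₀ : complexBetti D.𝒥.J.X 2),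
      ¬ D.𝒥.IsHyperelliptic ∧ OrbitTranslatesDisjoint D.𝒥 D.G₁ D.G₂ ∧ D.𝒥.J.IsPolarizationClassOf D.Θ θ₀ ∧ complexBetti.map e.inv 2 θ = D.hY θ₀) :
    ∃ w : complexBetti X (2 * 3), w ∈ secantQuotientServedClassesPinned X θ ∧ IsRationalClass w ∧
      w ∈ carriedClasses (twistedReflexiveClass C AdmTw') 6 3 X θ := by
  obtain ⟨D, e, θ₀, hnh, hH, hθ₀, hpin⟩ := hpres
  have hD : ∃ γ : complexBetti D.Y.X (2 * 3), IsTwistedCarrierWeilPairOn C AdmTw' D.𝒥.J D.isAmple D.KTheta_eq_bot D.G₁ D.G₂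
      D.succ_ne_zero D.G₁_le D.G₂_le D.d (D.hY θ₀) γ :=
    hLC D.d D.even D.four_le D.C D.smooth D.𝒥 D.dim_J D.Θ D.riemann D.principal D.G₁ D.G₂ D.G₁_le D.G₂_le hnh hH
      D.cyclic₁ D.card₁ D.cyclic₂ D.card₂ D.disjoint D.generalPosition θ₀ hθ₀
  obtain ⟨γ, hpol, hamp, hhyp, hγQ, hγray, hγW, hcopy⟩ := hD
  have hW : IsSecantQuotientWeilClassAtPinned D.Y.X (D.hY θ₀) γ :=
    IsSecantQuotientWeilClassAtPinned.of_refl D hθ₀ hpol hamp hhyp hγQ hγray hγW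
  have hθ : θ = complexBetti.map e.hom 2 (D.hY θ₀) := by rw [← hpin, e.complexBetti_map_hom_map_inv]
  obtain ⟨I, κ, c, h3, hκ, hκ3, hκk⟩ := hcopy X e
  refine ⟨complexBetti.map e.hom (2 * 3) γ, ?_, hγQ.map _, I, κ, 1, c, h3, hκ, one_ne_zero, ?_, fun k hk hk3 ↦ ?_⟩
  · rw [hθ]; exact hW.of_iso e
  · rw [one_smul, hθ]; exact hκ3
  · rw [hθ]; exact hκk k hk hk3

/-- **2s″ FROM THE NOWHERE-DISPLACEABLE LINE** — `AnchoredSpanAt` on the End-keyed anchor family from `hL`, the (c1) bound `hT`, the tree theorems (c2), (c3″),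
p664145's §3 composition and (c4-E), and THIS file's `printSheafHandleExistsEnd_of hR` in place of (c4) ∘ (c4a) (`Lines/MoverTrap.lean` rev 2 l.503ff transcribed).
[cite: Markman2025SecantWeil, Thm. 1.4.1 (item 4)] [cite: Raynaud1983SousVarietes, Théorème principal (p. 327)] -/
theorem anchoredSpan_63_offHypDisjEnd_of_pinnedForall_nowhereDisplaceable (hR : Raynaud1983_maninMumford)
    (hL : ∀ C : ChernCharacterBetti, Markman2025_secantQuotient_twistedCarrier_onJacobian_pinnedForall C AdmTw')
    (hT : IsogenyPushforwardAdmissibilityTransferPrime) :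
    ∀ C : ChernCharacterBetti, AnchoredSpanAt (twistedReflexiveClass C AdmTw') 6 3 offHypDisjEndAnchors
      (fun Y θ ↦ secantQuotientServedClassesPinned Y θ) servedPlusTheta :=
  fun C ↦ anchoredSpanAt_served_of_two_carried_served fun Y θ hY ↦ by
    obtain ⟨hpin, hpres⟩ := hY
    have hpres' := hpres
    obtain ⟨D, e, θ₀, hnh, hH, hθ₀, _, hpinθ⟩ := hpres'
    obtain ⟨γ₁, hγ₁, -, hc₁⟩ := exists_carried_pinned_of_presentedOffHypDisj_of_pinnedForall' (hL C) ⟨D, e, θ₀, hnh, hH, hθ₀, hpinθ⟩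
    have h2m := secondCarried_63_offHypDisjEnd_of_hGoodEndNodesEnd C
      (fun D θ₀ hnh hH hθ₀ hEnd _ _ hg hm0 hm1 hm2 _ 𝓓 hγ₁ hC =>
        D.exists_secondCarried_of_pinnedForall_of_movedData_at (hL C)
          (isogenyMovesPinnedTwistedData_prime_of_transfer_of_chernCharacter hT (isogenyPushforwardChernCharacter_holds C))
          hnh hH hθ₀ (pinnedWeilPlaneRigidity_offHypDisj_of_endRingInt D θ₀ hnh hH hθ₀ hEnd) hg hm0 hm1 hm2 𝓓 hγ₁ hC)
      (offDiagonalExtVanishing_someMover_End_of_printSheafHandleExistsEnd C (printSheafHandleExistsEnd_of hR C))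
    obtain ⟨γ₂, hγ₂, hc₂, hspan⟩ := h2m Y θ hpin hpres γ₁ hγ₁ hc₁
    exact ⟨γ₁, hγ₁, γ₂, hγ₂, hc₁, hc₂, hspan⟩

/-- **THE CRUX, HYPOTHESIS FORM, THROUGH THE NOWHERE-DISPLACEABLE RE-CUT OF (S4)** — from Raynaud 1983 (named fact), `h₁` = birth's 1′, `hT` = birth's (c1),
`h₂ᵣ` = birth's 2r″, `h₃` = birth's 3′ᴸ, the tree theorems (c2) ∕ (c3″) ∕ S2 ∕ S3, and THIS file's stubs (N-F), (N-I), (N-U) through `printSheafHandleExistsEnd_of`.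
`sorryAx` reaches it only through `stub_extJumpLocus_lifts`, `stub_properJump_of_confinedLifts`, `stub_upstairsProperJumpCarrierExists_End`. Nothing is thereby proved
(HC ∕ HC_AV ∕ HC_CM ∕ №4 NOT proved). [cite: Markman2025SecantWeil, Thm. 1.4.1 (item 4)] [cite: Raynaud1983SousVarietes, Théorème principal (p. 327)] -/
theorem DiagLocalOfMarkmanPinnedForall_of (hR : Raynaud1983_maninMumford)
    (h₁ : ∀ C : ChernCharacterBetti, LefAtExceptionalRegimeAt (twistedReflexiveClass C AdmTw') 4 2)
    (hT : IsogenyPushforwardAdmissibilityTransferPrime)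
    (h₂ᵣ : ∀ C : ChernCharacterBetti,
      ∀ (X : SchemeOver ℂ), (∃ A' : AbelianVariety ℂ, A'.dim = 6 ∧ Nonempty (A'.X ≅ X)) →
        ∀ w : complexBetti X (2 * 3), IsRationalClass w → IsOfHodgeType 6 X (2 * 3) 3 3 w →
          ¬ (w ∈ algebraicClasses X 3 ∧ w ∈ divisorClassesSpan X 6 3) →
          ¬ AnchorReachableAt 6 3 offHypDisjEndAnchors (fun Y θ ↦ secantQuotientServedClassesPinned Y θ) servedPlusTheta X w →
          LocallyServedAt (twistedReflexiveClass C AdmTw') 6 3 X w)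
    (h₃ : ∀ (C : ChernCharacterBetti) (m : ℕ), 4 ≤ m → LefAtExceptionalRegimeAtLocal (twistedReflexiveClass C AdmTw') (2 * m) m) :
    Summit.HodgeConjecture.HodgeConjecture.Theses.VHCAbelianSchemesRoad.DiagLocalOfMarkmanPinnedForall := by
  intro hL C m hm
  rcases Nat.lt_or_ge m 4 with hlt | hge
  · interval_cases m
    · exact lefAtExceptionalRegimeAtLocal_of_lefAtExceptionalRegimeAt (h₁ C)
    · exact lefAtExceptionalRegimeAtLocal_of_anchoredSpan_of_residual (twistedDoorPrime_respectsIso C)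
        (anchoredSpan_63_offHypDisjEnd_of_pinnedForall_nowhereDisplaceable hR hL hT C) (h₂ᵣ C)
  · exact h₃ C m hge

end CruxByName

#print axioms not_properJumpCarrierExists_End_iff_denseJump
#print axioms extJumpLocus_eq_univ_of_eulerPairing
#print axioms isMoverTrap_of_qImageOff_id_subset
#print axioms eulerPairing_eq_zero_of_printSheafHandle
#print axioms properJumpCarrierExists_End_of_line
#print axioms printSheafHandleExistsEnd_of_line
#print axioms DiagLocalOfMarkmanPinnedForall_of

end Summit.HodgeConjecture.HodgeConjecture.Cruxes.DiagLocalOfMarkmanPinnedForall.NowhereDisplaceable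

end
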